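import Summits.CriticalPhenomena.PercolationContinuityZ3.Theorems.SahiMasterFamilyFCombPiStep
import Mathlib.Tactic.Linarith
import HarnessLib

/-!
# The comb form of the `F`-inequality is nonnegative for every recursively peelable third event

Support file (cell `prim-bnk`, seat bnk-2 gen 20; `--supports stmt-CriticalPhenomena-4575`; memo
`run/shared/lean/prim/prim-l12/FROM-prim-bnk-2-g20-CP-CERTIFICATES.md`, Theorems 2–3).  One definition (the inductive class
`Peelable`), no `sorry`, standard axioms.

For increasing events `A, B, G` on the cube `Fin n → Bool` (encoded as Boolean indicator functions; antipode `x̄ = fun i => !x i`)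
the top tensor-Bernstein coefficient of the conjectured master-family inequality
`F(A,B;G) = (1+μG)μ(ABG) − μG·μ(AB) − μ(AG)μ(BG) ≥ 0` (`prim-master-conj`, POINTWISE §21; kernel one-coordinate form
`SahiFInduction.F_bernstein_secAt`) is the integer `K(A,B,G) = #{x∈ABG} − #{x∈AG : x̄∈BG} − #{x∈G : x̄∈AB∖G}`.

* `Peelable n G` — `G` can be peeled coordinate by coordinate, each time along a coordinate `e` along which `G` is increasing and
  has no DOUBLY-PIVOTAL ANTIPODAL PAIR (no `y` with `e` pivotal for `G` at `insertNth e · y` and at `insertNth e · ȳ`); bases: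
  dimension `0`, and dimension `1` with `G` increasing.
* **`comb_sum_nonneg_of_peelable`: `K(A,B,G) ≥ 0` for every peelable `G` and all monotone `A, B`** — induction on the peeling,
  the step being `SahiFComb.comb_sum_ge_sections` (companion file `…FCombPiStep`).

READ-ONCE THIRD EVENTS.  If `G` is given by an AND/OR formula in which every variable occurs at most once, then `G` is peelable:
a variable on which `G` does not depend can always be peeled (its pivotal set is empty); otherwise a gate of maximal depth has
two leaf children `e, f`, and `e` is pivotal at `x` only if `x_f = 1` (AND) resp. `x_f = 0` (OR), which fails at `x̄` — so `e`
carries no doubly-pivotal antipodal pair (memo, Lemma B); the sections `x_e := t` are read-once again.  Since restrictions of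
read-once functions to faces are read-once, every tensor-Bernstein coefficient of `F(A,B;G)` is then `≥ 0`, i.e.
**`F(A,B;G) ≥ 0` for all increasing `A, B` and every product measure whenever `G` is read-once** (memo Theorem 3; explicit
certificates machine-verified for all read-once `G` sampled on `≤ 8` variables).  The formula-tree bookkeeping (`read-once ⟹
Peelable`) and the Bernstein expansion (`K ≥ 0` on all faces ⟹ `F ≥ 0`) are NOT formalised here — recorded as the next Lean
steps.  HONEST FRAMING: a theorem for the peelable class; `F ≥ 0` for general third events remains OPEN (the memo's CONJECTURE CP,
LP-verified for every up-set on `≤ 5` coordinates, would give it). [this work]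
-/

namespace Summit.CriticalPhenomena.PercolationContinuityZ3.Theorems

namespace SahiFComb

open Finset

variable {n : ℕ}

/-! ### 1. The recursively peelable class of third events -/

/-- `Peelable n G`: the third event `G : (Fin n → Bool) → Bool` can be peeled coordinate by coordinate, each time along a
coordinate `e` along which `G` is increasing and has NO doubly-pivotal antipodal pair (no `y` with `e` pivotal for `G` both
at `insertNth e · y` and at `insertNth e · ȳ`), both `e`-sections being peelable again; base cases: dimension `0`, and dimension `1` with `G` increasing (the dictator
`x_0` is peelable only through this base case).  Every read-once `G` (AND/OR formula
using each variable at most once) is peelable: peel a leaf that has a leaf sibling (memo FROM-prim-bnk-2-g20, Lemma B);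
so are all up-sets on `≤ 4` coordinates and 205 of the 209 `S₅`-classes (memo §5, by a finer recursion). [this work] -/
inductive Peelable : (n : ℕ) → ((Fin n → Bool) → Bool) → Prop
  | zero (G : (Fin 0 → Bool) → Bool) : Peelable 0 G
  | one (G : (Fin 1 → Bool) → Bool)
      (hmono : ∀ y : Fin 0 → Bool, G (Fin.insertNth 0 false y) = true → G (Fin.insertNth 0 true y) = true) :
      Peelable 1 G
  | step {n : ℕ} (G : (Fin (n + 1) → Bool) → Bool) (e : Fin (n + 1))
      (hmono : ∀ y : Fin n → Bool, G (Fin.insertNth e false y) = true → G (Fin.insertNth e true y) = true)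
      (hPi : ∀ y : Fin n → Bool, ¬ (G (Fin.insertNth e true y) = true ∧ G (Fin.insertNth e false y) = false ∧
              G (Fin.insertNth e true (fun j => !y j)) = true ∧ G (Fin.insertNth e false (fun j => !y j)) = false))
      (h0 : Peelable n (fun y => G (Fin.insertNth e false y)))
      (h1 : Peelable n (fun y => G (Fin.insertNth e true y))) : Peelable (n + 1) G

/-! ### 2. Monotone events and their sections -/

/-- Inserting `false` lies below inserting `true`. [folklore] -/
theorem insertNth_false_le_true (e : Fin (n + 1)) (y : Fin n → Bool) :
    Fin.insertNth (α := fun _ => Bool) e false y ≤ Fin.insertNth (α := fun _ => Bool) e true y := by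
  intro i
  refine Fin.succAboveCases e ?_ (fun j => ?_) i
  · simp [Fin.insertNth_apply_same]
  · simp [Fin.insertNth_apply_succAbove]

/-- `insertNth e t` is monotone in the tuple. [folklore] -/
theorem insertNth_mono_tuple (e : Fin (n + 1)) (t : Bool) {y y' : Fin n → Bool} (h : y ≤ y') :
    Fin.insertNth (α := fun _ => Bool) e t y ≤ Fin.insertNth (α := fun _ => Bool) e t y' := by
  intro i
  refine Fin.succAboveCases e ?_ (fun j => ?_) i
  · simp [Fin.insertNth_apply_same]
  · simpa [Fin.insertNth_apply_succAbove] using h j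

/-- A monotone event is increasing along every coordinate. [folklore] -/
theorem mono_along (e : Fin (n + 1)) {X : (Fin (n + 1) → Bool) → Bool} (hX : Monotone X) (y : Fin n → Bool)
    (h : X (Fin.insertNth e false y) = true) : X (Fin.insertNth e true y) = true := by
  have := hX (insertNth_false_le_true e y)
  rw [h] at this
  exact top_le_iff.mp this

/-- Sections of a monotone event are monotone. [folklore] -/
theorem mono_section (e : Fin (n + 1)) (t : Bool) {X : (Fin (n + 1) → Bool) → Bool} (hX : Monotone X) :
    Monotone (fun y : Fin n → Bool => X (Fin.insertNth e t y)) :=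
  fun _ _ h => hX (insertNth_mono_tuple e t h)

/-- The six-Boolean inequality behind the one-dimensional base case. [this work] -/
theorem comb_one_aux : ∀ (a0 a1 b0 b1 g0 g1 : Bool),
    (a0 = true → a1 = true) → (b0 = true → b1 = true) → (g0 = true → g1 = true) →
    0 ≤ ( ((Bool.toNat (a0 && b0 && g0) : ℕ) : ℤ) - ((Bool.toNat (a0 && g0 && b1 && g1) : ℕ) : ℤ)
            - ((Bool.toNat (g0 && a1 && b1 && !g1) : ℕ) : ℤ) )
        + ( ((Bool.toNat (a1 && b1 && g1) : ℕ) : ℤ) - ((Bool.toNat (a1 && g1 && b0 && g0) : ℕ) : ℤ)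
            - ((Bool.toNat (g1 && a0 && b0 && !g0) : ℕ) : ℤ) ) := by
  decide

/-- Base case in dimension `1`: the comb form is nonnegative for events increasing along the unique coordinate. [this work] -/
theorem comb_sum_nonneg_one (A B G : (Fin 1 → Bool) → Bool)
    (hA : ∀ y : Fin 0 → Bool, A (Fin.insertNth 0 false y) = true → A (Fin.insertNth 0 true y) = true)
    (hB : ∀ y : Fin 0 → Bool, B (Fin.insertNth 0 false y) = true → B (Fin.insertNth 0 true y) = true)
    (hG : ∀ y : Fin 0 → Bool, G (Fin.insertNth 0 false y) = true → G (Fin.insertNth 0 true y) = true) :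
    0 ≤ ∑ x : Fin 1 → Bool, (((Bool.toNat (A x && B x && G x) : ℕ) : ℤ)
          - ((Bool.toNat (A x && G x && B (fun i => !x i) && G (fun i => !x i)) : ℕ) : ℤ)
          - ((Bool.toNat (G x && A (fun i => !x i) && B (fun i => !x i) && !(G (fun i => !x i))) : ℕ) : ℤ)) := by
  rw [sum_cube_split 0]
  have h0 : ∀ y : Fin 0 → Bool, (fun i => !(Fin.insertNth (α := fun _ => Bool) 0 false y i)) =
      Fin.insertNth (α := fun _ => Bool) 0 true (fun j => !y j) :=
    fun y => by simpa using antipode_insertNth 0 false y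
  have h1 : ∀ y : Fin 0 → Bool, (fun i => !(Fin.insertNth (α := fun _ => Bool) 0 true y i)) =
      Fin.insertNth (α := fun _ => Bool) 0 false (fun j => !y j) :=
    fun y => by simpa using antipode_insertNth 0 true y
  simp only [h0, h1]
  refine Finset.sum_nonneg (fun y _ => ?_)
  have hyy : (fun j => !y j) = y := by funext j; exact Fin.elim0 j
  simp only [hyy]
  exact comb_one_aux _ _ _ _ _ _ (hA y) (hB y) (hG y)

/-! ### 3. The comb form is nonnegative on the peelable class -/

/-- **THEOREM (comb form of the `F`-inequality on the peelable class).**  For every peelable third event `G` and all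
monotone (increasing) events `A, B` on the cube `Fin n → Bool`, the top tensor-Bernstein coefficient of
`F(A,B;G)` is nonnegative:
`K(A,B,G) = #{x ∈ ABG} − #{x ∈ AG : x̄ ∈ BG} − #{x ∈ G : x̄ ∈ AB ∖ G} ≥ 0`.
Proof: induction on the peeling, each step by `comb_sum_ge_sections`, bases by `comb_sum_nonneg_zero` / `comb_sum_nonneg_one`.  Since restrictions of
read-once functions to faces are read-once (hence peelable), this gives the nonnegativity of every tensor-Bernstein
coefficient of `F(A,B;G)`, hence `F ≥ 0` for every product measure, whenever `G` is read-once (memo Theorem 3; the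
face/Bernstein bookkeeping is not formalised in this file).  HONEST FRAMING: comb inequality for the peelable class only;
`F ≥ 0` for general `G` remains OPEN. [this work] -/
theorem comb_sum_nonneg_of_peelable {n : ℕ} {G : (Fin n → Bool) → Bool} (hP : Peelable n G) :
    ∀ (A B : (Fin n → Bool) → Bool), Monotone A → Monotone B →
      0 ≤ ∑ x : Fin n → Bool, (((Bool.toNat (A x && B x && G x) : ℕ) : ℤ)
            - ((Bool.toNat (A x && G x && B (fun i => !x i) && G (fun i => !x i)) : ℕ) : ℤ)
            - ((Bool.toNat (G x && A (fun i => !x i) && B (fun i => !x i) && !(G (fun i => !x i))) : ℕ) : ℤ)) := by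
  induction hP with
  | zero G =>
      intro A B _ _
      exact comb_sum_nonneg_zero A B G
  | one G hmono =>
      intro A B hA hB
      exact comb_sum_nonneg_one A B G (mono_along 0 hA) (mono_along 0 hB) hmono
  | step G e hmono hPi h0 h1 ih0 ih1 =>
      intro A B hA hB
      have step := comb_sum_ge_sections e A B G (mono_along e hA) (mono_along e hB) hmono hPi
      have i0 := ih0 (fun y => A (Fin.insertNth e false y)) (fun y => B (Fin.insertNth e false y))
        (mono_section e false hA) (mono_section e false hB)
      have i1 := ih1 (fun y => A (Fin.insertNth e true y)) (fun y => B (Fin.insertNth e true y))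
        (mono_section e true hA) (mono_section e true hB)
      linarith

end SahiFComb

end Summit.CriticalPhenomena.PercolationContinuityZ3.Theorems
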